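import Literature.Analysis.Pluripotential.RegularLocusLeviForm
import Literature.Analysis.Complex.CauchyPompeiu
import HarnessLib

/-!
# Stokes' theorem for Monge–Ampère densities on `ℂᴺ`: compactly supported perturbations do not
# change the total mass

Topic `Literature/Analysis/Pluripotential`. The "integration by parts" step of the proof of the named
fact `GuedjZeriahi2007_lelongNumber_eq_zero_of_regularMass_eq` (`NonPluripolarMongeAmpereMass.lean`),
in the classical smooth setting: for `q, φ : ℂᴺ → ℝ` of class `C³` with `φ` COMPACTLY SUPPORTED,
`∫_{ℂᴺ} (dd^c(q + φ))ᴺ = ∫_{ℂᴺ} (dd^c q)ᴺ`, i.e. `∫ (MA(q+φ) − MA(q)) dλ = 0` for the densities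
`MA = heightDensity N = N!(2/π)ᴺ det(∂²/∂w_i∂w̄_l)` of `BiextensionHeightPackage.lean`. No
differential forms are used: the exactness `(dd^c u)ᴺ − (dd^c v)ᴺ = d(…)` is replaced by an explicit
row-by-row expansion and the divergence-freeness of cofactors.

## Contents

* `∂̄`-calculus for complex-valued functions on a complex normed space, on top of
  `Literature.Analysis.Complex.dbarAlong` (the Cauchy–Riemann operator `∂̄_v` of
  `CauchyPompeiu.lean`): `dbarAlong_eq`, Leibniz rules `dbarAlong_mul`, `dbarAlong_const_mul`,
  `dbarAlong_finset_sum`, `dbarAlong_finset_prod`, **`dbarAlong_det_of_differentiableAt`** (derivative of a determinant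
  = sum over rows), `hasFDerivAt_dbarAlong`, `contDiff_dbarAlong`, **`dbarAlong_dbarAlong_comm_of_contDiff`**
  (`∂̄_u ∂̄_v = ∂̄_v ∂̄_u` on `C²`), `hasCompactSupport_dbarAlong`.
* `det_updateRow_eq_sum` (Laplace expansion along an updated row),
  `det_updateRow_updateRow_single_swap`, and **`sum_dbarAlong_det_updateRow_eq_zero`**: for `C²`
  functions `f_i` and `M_{il} = ∂̄_l f_i`, `Σ_k ∂̄_k det(M; row k₀ ↦ e_k) = 0` (symmetry of
  `∂̄_k∂̄_l` against antisymmetry under the exchange of the two distinguished rows).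
* **`integral_dbarAlong_mul_eq_neg`** — integration by parts `∫ (∂̄_v F) G = -∫ F ∂̄_v G` on `ℂⁿ`
  for `C¹` functions, `F` compactly supported (from Mathlib's
  `integral_mul_fderiv_eq_neg_fderiv_mul_of_integrable` in the directions `v`, `iv`);
  **`integral_det_dbarAlong_eq_zero`** — `∫ det(∂̄_l f_i) dλ = 0` when some `f_i` has compact support.
* **`leviMatrix_eq_dbarAlong`** — the Levi matrix of a real `C²` function is a matrix of
  `∂̄`-gradients: `(leviMatrix u w)_{il} = ∂̄_{e_l} (conj ∘ ∂̄_{e_i} u)(w) = ∂²u/∂w_i∂w̄_l`;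
  `leviMatrix_add`, `leviMatrix_congr_of_eventuallyEq`, `continuous_leviMatrix_apply_of_contDiff_two`,
  `continuous_heightDensity_self`, `contDiff_matrix_det`.
* `det_add_sub_det_eq_sum` — telescoping `det(A+B) − det A = Σ_j det(rows <j of A+B; row j of B;
  rows >j of A)`.
* **`integral_det_leviMatrix_add_sub_eq_zero`**, **`integral_heightDensity_add_sub_eq_zero`**
  (`∫ (MA(q+φ) − MA(q)) = 0`, with integrability) and **`lintegral_heightDensity_add_eq`**
  (`∫⁻ MA(q+φ) = ∫⁻ MA(q)` when both densities are `≥ 0`), for `q, φ ∈ C³`, `φ` compactly supported.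

Everything is PROVED; no definitions, no named facts. (The sibling file `MongeAmpereMassInvariance.lean`
proves the signed identity for `C^∞` data by differentiating along the pencil `v + sψ`; the present
file is independent of it, works in class `C³`, and adds the `[0, ∞]`-valued form needed for
`regularMass`.)

## References

* Standard (Stokes' theorem for `dd^c`-exact top forms; e.g. the "Stokes" step in Guedj–Zeriahi 2007,
  §1.1, `∫_X (ω + dd^c φ)ⁿ = ∫_X ωⁿ`); tagged folklore.
-/

noncomputable section

open scoped Topology ComplexConjugate
open MeasureTheory Filter Set Complex Matrix
open Literature.Analysis.Complex (dbarAlong dbarAlong_apply)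

namespace Literature.Analysis.Pluripotential

section DbarCalculus

variable {E : Type*} [NormedAddCommGroup E] [NormedSpace ℂ E]

/-- `∂̄_v F = ½ (DF[v] + i DF[iv])` for complex-valued `F`. [folklore] -/
theorem dbarAlong_eq (v : E) (F : E → ℂ) (x : E) :
    dbarAlong v F x = (fderiv ℝ F x v + I * fderiv ℝ F x (I • v)) / 2 := by
  rw [dbarAlong_apply, smul_eq_mul, smul_eq_mul]
  ring

/-- `∂̄_v` of a constant vanishes. [folklore] -/
theorem dbarAlong_fun_const (v : E) (c : ℂ) (x : E) : dbarAlong v (fun _ : E ↦ c) x = 0 := by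
  simp [dbarAlong_apply]

/-- **Leibniz rule** for `∂̄_v` on complex-valued functions. [folklore] -/
theorem dbarAlong_mul {F G : E → ℂ} {x : E} (hF : DifferentiableAt ℝ F x)
    (hG : DifferentiableAt ℝ G x) (v : E) :
    dbarAlong v (fun y ↦ F y * G y) x = dbarAlong v F x * G x + F x * dbarAlong v G x := by
  simp only [dbarAlong_eq, fderiv_fun_mul hF hG, _root_.add_apply, _root_.smul_apply, smul_eq_mul]
  ring

/-- `∂̄_v (c F) = c ∂̄_v F`. [folklore] -/
theorem dbarAlong_const_mul {F : E → ℂ} {x : E} (hF : DifferentiableAt ℝ F x) (c : ℂ) (v : E) :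
    dbarAlong v (fun y ↦ c * F y) x = c * dbarAlong v F x := by
  rw [dbarAlong_mul (differentiableAt_const c) hF, dbarAlong_fun_const, zero_mul, zero_add]

/-- `∂̄_v` of a finite sum. [folklore] -/
theorem dbarAlong_finset_sum {ι : Type*} (s : Finset ι) {F : ι → E → ℂ} {x : E}
    (hF : ∀ i ∈ s, DifferentiableAt ℝ (F i) x) (v : E) :
    dbarAlong v (fun y ↦ ∑ i ∈ s, F i y) x = ∑ i ∈ s, dbarAlong v (F i) x := by
  simp only [dbarAlong_eq, fderiv_fun_sum hF, _root_.sum_apply, Finset.mul_sum,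
    ← Finset.sum_add_distrib, Finset.sum_div]

/-- `∂̄_v` of a finite product (Leibniz). [folklore] -/
theorem dbarAlong_finset_prod {ι : Type*} [DecidableEq ι] (s : Finset ι) {F : ι → E → ℂ} {x : E}
    (hF : ∀ i ∈ s, DifferentiableAt ℝ (F i) x) (v : E) :
    dbarAlong v (fun y ↦ ∏ i ∈ s, F i y) x
      = ∑ i ∈ s, (∏ j ∈ s.erase i, F j x) * dbarAlong v (F i) x := by
  have h := HasFDerivAt.finsetProd (fun i hi ↦ (hF i hi).hasFDerivAt)
  rw [dbarAlong_eq, show (fun y ↦ ∏ i ∈ s, F i y) = (∏ i ∈ s, F i ·) from rfl, h.fderiv]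
  simp only [_root_.sum_apply, _root_.smul_apply, smul_eq_mul,
    Finset.mul_sum, ← Finset.sum_add_distrib, Finset.sum_div, dbarAlong_eq]
  exact Finset.sum_congr rfl fun i _ ↦ by ring

/-- **`∂̄_v` of a determinant**: the sum over the rows of the determinants with that row
differentiated. [folklore] -/
theorem dbarAlong_det_of_differentiableAt {n : ℕ} {M : E → Matrix (Fin n) (Fin n) ℂ} {x : E}
    (hM : ∀ i l, DifferentiableAt ℝ (fun y ↦ M y i l) x) (v : E) :
    dbarAlong v (fun y ↦ (M y).det) x
      = ∑ r, ((M x).updateRow r fun l ↦ dbarAlong v (fun y ↦ M y r l) x).det := by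
  simp only [Matrix.det_apply']
  have hprod : ∀ σ : Equiv.Perm (Fin n), DifferentiableAt ℝ (fun y ↦ ∏ i, M y (σ i) i) x :=
    fun σ ↦ (HasFDerivAt.finsetProd (u := Finset.univ) (g := fun i y ↦ M y (σ i) i)
      fun i _ ↦ (hM (σ i) i).hasFDerivAt).differentiableAt
  rw [dbarAlong_finset_sum Finset.univ
    (F := fun σ y ↦ ((Equiv.Perm.sign σ : ℤ) : ℂ) * ∏ i, M y (σ i) i)
    (fun σ _ ↦ ((differentiableAt_const _).hasFDerivAt.mul (hprod σ).hasFDerivAt).differentiableAt)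
    v]
  have hσ : ∀ σ : Equiv.Perm (Fin n),
      dbarAlong v (fun y ↦ ((Equiv.Perm.sign σ : ℤ) : ℂ) * ∏ i, M y (σ i) i) x
        = ((Equiv.Perm.sign σ : ℤ) : ℂ) * ∑ j, (∏ i ∈ Finset.univ.erase j, M x (σ i) i)
            * dbarAlong v (fun y ↦ M y (σ j) j) x := by
    intro σ
    rw [dbarAlong_const_mul (hprod σ), dbarAlong_finset_prod Finset.univ (fun i _ ↦ hM (σ i) i)]
  simp only [hσ]
  rw [Finset.sum_comm]
  refine Finset.sum_congr rfl fun σ _ ↦ ?_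
  rw [Finset.mul_sum]
  conv_rhs => rw [← Equiv.sum_comp σ]
  refine Finset.sum_congr rfl fun j _ ↦ ?_
  congr 1
  -- the product over `i` of the updated matrix picks the new row exactly at `i = j`
  have key : ∀ i, ((M x).updateRow (σ j) fun l ↦ dbarAlong v (fun y ↦ M y (σ j) l) x) (σ i) i
      = if i = j then dbarAlong v (fun y ↦ M y (σ j) i) x else M x (σ i) i := by
    intro i
    rw [Matrix.updateRow_apply]
    by_cases hij : i = j
    · subst hij; simp
    · simp [σ.injective.ne hij, hij]
  simp_rw [key]
  rw [Finset.prod_ite, Finset.filter_eq' Finset.univ j, Finset.filter_ne' Finset.univ j]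
  simp only [Finset.mem_univ, if_true, Finset.prod_singleton]
  ring

/-- For `F` of class `C²`, `w ↦ ∂̄_v F(w)` has the derivative
`a ↦ ½ (D²F(x)(a)(v) + i D²F(x)(a)(iv))`. [folklore] -/
theorem hasFDerivAt_dbarAlong {F : E → ℂ} (hF : ContDiff ℝ 2 F) (v x : E) :
    HasFDerivAt (fun w ↦ dbarAlong v F w)
      ((2 : ℂ)⁻¹ • ((ContinuousLinearMap.apply ℝ ℂ v).comp (fderiv ℝ (fderiv ℝ F) x)
        + I • (ContinuousLinearMap.apply ℝ ℂ (I • v)).comp (fderiv ℝ (fderiv ℝ F) x))) x := by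
  have h2 : HasFDerivAt (fderiv ℝ F) (fderiv ℝ (fderiv ℝ F) x) x :=
    ((hF.fderiv_right (m := 1) le_rfl).differentiable one_ne_zero x).hasFDerivAt
  have hv := (ContinuousLinearMap.apply ℝ ℂ v).hasFDerivAt.comp x h2
  have hIv := (ContinuousLinearMap.apply ℝ ℂ (I • v)).hasFDerivAt.comp x h2
  have h := (hv.add (hIv.const_smul I)).const_smul (2 : ℂ)⁻¹
  refine h.congr_of_eventuallyEq (Eventually.of_forall fun w ↦ ?_)
  simp [dbarAlong_apply]

/-- For `F` of class `C²`, `w ↦ ∂̄_v F(w)` is differentiable. [folklore] -/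
theorem differentiableAt_dbarAlong {F : E → ℂ} (hF : ContDiff ℝ 2 F) (v x : E) :
    DifferentiableAt ℝ (fun w ↦ dbarAlong v F w) x :=
  (hasFDerivAt_dbarAlong hF v x).differentiableAt

/-- For `F` of class `C^{k+1}`, `w ↦ ∂̄_v F(w)` is of class `C^k`. [folklore] -/
theorem contDiff_dbarAlong {F : E → ℂ} {k : ℕ} (hF : ContDiff ℝ (k + 1) F) (v : E) :
    ContDiff ℝ k fun w ↦ dbarAlong v F w := by
  have h1 : ContDiff ℝ k (fderiv ℝ F) := hF.fderiv_right (m := k) le_rfl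
  have : (fun w ↦ dbarAlong v F w)
      = fun w ↦ (2 : ℂ)⁻¹ • (fderiv ℝ F w v + I • fderiv ℝ F w (I • v)) := rfl
  rw [this]
  exact ((h1.clm_apply contDiff_const).add ((h1.clm_apply contDiff_const).const_smul I)).const_smul _

/-- **`∂̄_u` and `∂̄_v` commute** on `C²` functions (symmetry of the second derivative).
[folklore] -/
theorem dbarAlong_dbarAlong_comm_of_contDiff {F : E → ℂ} (hF : ContDiff ℝ 2 F) (u v x : E) :
    dbarAlong u (fun w ↦ dbarAlong v F w) x = dbarAlong v (fun w ↦ dbarAlong u F w) x := by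
  have hsymm : ∀ a b, fderiv ℝ (fderiv ℝ F) x a b = fderiv ℝ (fderiv ℝ F) x b a :=
    fun a b ↦ (hF.contDiffAt.isSymmSndFDerivAt (by simp)) a b
  rw [dbarAlong_apply, dbarAlong_apply, (hasFDerivAt_dbarAlong hF v x).fderiv,
    (hasFDerivAt_dbarAlong hF u x).fderiv]
  simp only [_root_.smul_apply, _root_.add_apply, ContinuousLinearMap.coe_comp,
    Function.comp_apply, ContinuousLinearMap.apply_apply, smul_eq_mul,
    hsymm v u, hsymm (I • v) u, hsymm v (I • u), hsymm (I • v) (I • u)]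
  ring

end DbarCalculus

/-! ### Divergence-free rows of cofactors -/

section Cofactor

variable {n : ℕ}

/-- Laplace expansion of a determinant along an updated row:
`det(B with row r := c) = Σ_l c_l det(B with row r := e_l)`. [folklore] -/
theorem det_updateRow_eq_sum (B : Matrix (Fin n) (Fin n) ℂ) (r : Fin n) (c : Fin n → ℂ) :
    (B.updateRow r c).det = ∑ l, c l * (B.updateRow r (Pi.single l 1)).det := by
  rw [Matrix.det_eq_sum_mul_adjugate_row _ r]
  refine Finset.sum_congr rfl fun l _ ↦ ?_
  rw [Matrix.updateRow_self, Matrix.adjugate_apply, Matrix.updateRow_idem]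

/-- Swapping the two distinguished rows: `det(A; k₀ ↦ e_l, r ↦ e_k) = -det(A; k₀ ↦ e_k, r ↦ e_l)`
for `k₀ ≠ r`. [folklore] -/
theorem det_updateRow_updateRow_single_swap (A : Matrix (Fin n) (Fin n) ℂ) {k₀ r : Fin n}
    (h : k₀ ≠ r) (k l : Fin n) :
    ((A.updateRow k₀ (Pi.single l 1)).updateRow r (Pi.single k 1)).det
      = -((A.updateRow k₀ (Pi.single k 1)).updateRow r (Pi.single l 1)).det := by
  have hP : (A.updateRow k₀ (Pi.single l (1 : ℂ))).updateRow r (Pi.single k 1)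
      = ((A.updateRow k₀ (Pi.single k (1 : ℂ))).updateRow r (Pi.single l 1)).submatrix
          (Equiv.swap k₀ r) id := by
    ext i j
    simp only [Matrix.submatrix_apply, id_eq, Matrix.updateRow_apply]
    by_cases hir : i = r
    · subst hir
      simp [Equiv.swap_apply_right, h]
    · by_cases hik : i = k₀
      · subst hik
        simp [Equiv.swap_apply_left, h]
      · simp [Equiv.swap_apply_of_ne_of_ne hik hir, hir, hik]
  rw [hP, Matrix.det_permute, Equiv.Perm.sign_swap h]
  simp

/-- **The cofactors along a row of a matrix of `∂̄`-gradients are divergence free**: for `C²`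
functions `f_i` and `M(w)_{il} = ∂̄_l f_i(w)`, `Σ_k ∂̄_k det(M(w); row k₀ ↦ e_k) = 0` (the terms
pair off by the symmetry `∂̄_k∂̄_l = ∂̄_l∂̄_k` against the antisymmetry of the determinant under the
exchange of the two distinguished rows). [folklore] -/
theorem sum_dbarAlong_det_updateRow_eq_zero {f : Fin n → (Fin n → ℂ) → ℂ}
    (hf : ∀ i, ContDiff ℝ 2 (f i)) (k₀ : Fin n) (x : Fin n → ℂ) :
    ∑ k, dbarAlong (Pi.single k 1) (fun y ↦ ((Matrix.of fun i l ↦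
      dbarAlong (Pi.single l 1) (f i) y).updateRow k₀ (Pi.single k 1)).det) x = 0 := by
  set A : Matrix (Fin n) (Fin n) ℂ := Matrix.of fun i l ↦ dbarAlong (Pi.single l 1) (f i) x with hA
  -- second `∂̄`-derivatives, symmetric in `(k, l)`
  set H : Fin n → Fin n → Fin n → ℂ := fun r k l ↦
    dbarAlong (Pi.single k 1) (fun y ↦ dbarAlong (Pi.single l 1) (f r) y) x with hH
  have hHsymm : ∀ r k l, H r k l = H r l k := fun r k l ↦ dbarAlong_dbarAlong_comm_of_contDiff (hf r) _ _ _
  -- Step 1: differentiate each determinant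
  have hstep1 : ∀ k, dbarAlong (Pi.single k 1) (fun y ↦ ((Matrix.of fun i l ↦
      dbarAlong (Pi.single l 1) (f i) y).updateRow k₀ (Pi.single k 1)).det) x
        = ∑ r ∈ Finset.univ.erase k₀, ((A.updateRow k₀ (Pi.single k 1)).updateRow r (H r k)).det := by
    intro k
    have hdiff : ∀ i l, DifferentiableAt ℝ (fun y ↦ ((Matrix.of fun i l ↦
        dbarAlong (Pi.single l 1) (f i) y).updateRow k₀ (Pi.single k 1)) i l) x := by
      intro i l
      by_cases hi : i = k₀
      · subst hi
        simp only [Matrix.updateRow_self]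
        exact differentiableAt_const _
      · simp only [Matrix.updateRow_ne hi, Matrix.of_apply]
        exact differentiableAt_dbarAlong (hf i) _ _
    rw [dbarAlong_det_of_differentiableAt hdiff, ← Finset.add_sum_erase _ _ (Finset.mem_univ k₀)]
    -- the term `r = k₀` vanishes: the differentiated row is the derivative of a constant row
    have hzero : ((((Matrix.of fun i l ↦ dbarAlong (Pi.single l 1) (f i) x).updateRow k₀ (Pi.single k 1)).updateRow
        k₀ fun l ↦ dbarAlong (Pi.single k 1) (fun y ↦ ((Matrix.of fun i l ↦
          dbarAlong (Pi.single l 1) (f i) y).updateRow k₀ (Pi.single k 1)) k₀ l) x)).det = 0 := by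
      refine Matrix.det_eq_zero_of_row_eq_zero k₀ fun l ↦ ?_
      simp only [Matrix.updateRow_self]
      exact dbarAlong_fun_const _ _ _
    rw [hzero, zero_add]
    refine Finset.sum_congr rfl fun r hr ↦ ?_
    have hrk : r ≠ k₀ := Finset.ne_of_mem_erase hr
    congr 1
    ext i l
    simp only [Matrix.updateRow_apply, hA, hH, Matrix.of_apply]
    by_cases hir : i = r
    · subst hir
      simp [hrk]
    · simp [hir]
  simp_rw [hstep1]
  -- Step 2: expand the differentiated row `H r k = Σ_l H r k l e_l` and swap the sums
  rw [Finset.sum_comm]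
  refine Finset.sum_eq_zero fun r hr ↦ ?_
  have hrk : r ≠ k₀ := Finset.ne_of_mem_erase hr
  have hexp : ∀ k, ((A.updateRow k₀ (Pi.single k 1)).updateRow r (H r k)).det
      = ∑ l, H r k l * ((A.updateRow k₀ (Pi.single k 1)).updateRow r (Pi.single l 1)).det :=
    fun k ↦ det_updateRow_eq_sum _ _ _
  simp_rw [hexp]
  -- Step 3: `S = -S`
  set S := ∑ k, ∑ l, H r k l * ((A.updateRow k₀ (Pi.single k 1)).updateRow r (Pi.single l 1)).det with hS
  have hanti : ∀ k l, ((A.updateRow k₀ (Pi.single l 1)).updateRow r (Pi.single k 1)).det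
      = -((A.updateRow k₀ (Pi.single k 1)).updateRow r (Pi.single l 1)).det :=
    fun k l ↦ det_updateRow_updateRow_single_swap A hrk.symm k l
  have hSS : S = -S := by
    calc S = ∑ l, ∑ k, H r l k * ((A.updateRow k₀ (Pi.single l 1)).updateRow r (Pi.single k 1)).det := by
          rw [hS, Finset.sum_comm]
      _ = ∑ l, ∑ k, -(H r k l * ((A.updateRow k₀ (Pi.single k 1)).updateRow r (Pi.single l 1)).det) := by
          refine Finset.sum_congr rfl fun l _ ↦ Finset.sum_congr rfl fun k _ ↦ ?_
          rw [hHsymm r l k, hanti k l, mul_neg]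
      _ = -S := by
          rw [hS, Finset.sum_comm]
          simp only [Finset.sum_neg_distrib]
  have h2 : (2 : ℂ) * S = 0 := by linear_combination hSS
  simpa using h2

end Cofactor

/-! ### Integration by parts for `∂̄` on `ℂⁿ`; determinants of `∂̄`-gradients integrate to zero -/

section Integral

variable {n : ℕ}

/-- **Integration by parts for `∂̄_v` on `ℂⁿ`**: `∫ (∂̄_v F) G = -∫ F (∂̄_v G)` for `F, G` of class
`C¹` with `F` compactly supported (no boundary term). [folklore] -/
theorem integral_dbarAlong_mul_eq_neg {F G : (Fin n → ℂ) → ℂ} (hF : ContDiff ℝ 1 F)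
    (hG : ContDiff ℝ 1 G) (hFc : HasCompactSupport F) (v : Fin n → ℂ) :
    ∫ w, dbarAlong v F w * G w = -∫ w, F w * dbarAlong v G w := by
  have hFcont : Continuous F := hF.continuous
  have hGcont : Continuous G := hG.continuous
  have hF' : ∀ u : Fin n → ℂ, Continuous fun w ↦ fderiv ℝ F w u := fun u ↦
    (hF.continuous_fderiv one_ne_zero).clm_apply continuous_const
  have hG' : ∀ u : Fin n → ℂ, Continuous fun w ↦ fderiv ℝ G w u := fun u ↦
    (hG.continuous_fderiv one_ne_zero).clm_apply continuous_const
  have hF'c : ∀ u : Fin n → ℂ, HasCompactSupport fun w ↦ fderiv ℝ F w u := fun u ↦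
    hFc.fderiv_apply (𝕜 := ℝ) u
  -- the directional identities
  have key : ∀ u : Fin n → ℂ, ∫ w, fderiv ℝ F w u * G w = -∫ w, F w * fderiv ℝ G w u := by
    intro u
    have h := integral_mul_fderiv_eq_neg_fderiv_mul_of_integrable (μ := volume) (f := F) (g := G)
      (v := u) (((hF' u).mul hGcont).integrable_of_hasCompactSupport (hF'c u).mul_right)
      ((hFcont.mul (hG' u)).integrable_of_hasCompactSupport hFc.mul_right)
      ((hFcont.mul hGcont).integrable_of_hasCompactSupport hFc.mul_right)
      (fun x _ ↦ hF.differentiable one_ne_zero x) (fun x _ ↦ hG.differentiable one_ne_zero x)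
    rw [h, neg_neg]
  -- integrability of the pieces
  have i1 : ∀ u : Fin n → ℂ, Integrable fun w ↦ fderiv ℝ F w u * G w := fun u ↦
    ((hF' u).mul hGcont).integrable_of_hasCompactSupport (hF'c u).mul_right
  have i2 : ∀ u : Fin n → ℂ, Integrable fun w ↦ F w * fderiv ℝ G w u := fun u ↦
    (hFcont.mul (hG' u)).integrable_of_hasCompactSupport hFc.mul_right
  have hL : ∀ w, dbarAlong v F w * G w
      = 2⁻¹ * (fderiv ℝ F w v * G w) + (2⁻¹ * I) * (fderiv ℝ F w (I • v) * G w) := by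
    intro w; rw [dbarAlong_eq]; ring
  have hR : ∀ w, F w * dbarAlong v G w
      = 2⁻¹ * (F w * fderiv ℝ G w v) + (2⁻¹ * I) * (F w * fderiv ℝ G w (I • v)) := by
    intro w; rw [dbarAlong_eq]; ring
  simp_rw [hL, hR]
  rw [integral_add ((i1 v).const_mul _) ((i1 (I • v)).const_mul _),
    integral_add ((i2 v).const_mul _) ((i2 (I • v)).const_mul _),
    integral_const_mul, integral_const_mul, integral_const_mul, integral_const_mul,
    key v, key (I • v)]
  ring

/-- `∂̄_v` of a compactly supported function has compact support. [folklore] -/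
theorem hasCompactSupport_dbarAlong {E : Type*} [NormedAddCommGroup E] [NormedSpace ℂ E]
    {F : E → ℂ} (hF : HasCompactSupport F) (v : E) :
    HasCompactSupport fun w ↦ dbarAlong v F w := by
  have h1 := (hF.fderiv_apply (𝕜 := ℝ) v).add
    ((hF.fderiv_apply (𝕜 := ℝ) (I • v)).mul_left (f := fun _ ↦ I))
  refine (h1.mul_right (f' := fun _ ↦ (2 : ℂ)⁻¹)).mono fun w hw ↦ ?_
  simp only [Function.mem_support, ne_eq, dbarAlong_eq, Pi.add_apply, Pi.mul_apply,
    div_eq_mul_inv] at hw ⊢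
  exact hw

/-- A determinant of `C^k` functions is `C^k`. [folklore] -/
theorem contDiff_matrix_det {E : Type*} [NormedAddCommGroup E] [NormedSpace ℝ E] {k : ℕ∞}
    {M : E → Matrix (Fin n) (Fin n) ℂ} (hM : ∀ i l, ContDiff ℝ k fun y ↦ M y i l) :
    ContDiff ℝ k fun y ↦ (M y).det := by
  simp only [Matrix.det_apply']
  exact ContDiff.sum fun σ _ ↦ contDiff_const.mul (contDiff_prod fun i _ ↦ hM (σ i) i)

/-- **The determinant of a matrix of `∂̄`-gradients `(∂̄_l f_i)` integrates to zero over `ℂⁿ`** as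
soon as one of the `C²` functions `f_i` has compact support: expand along that row, integrate by
parts, and use that the cofactors are divergence free
(`sum_dbarAlong_det_updateRow_eq_zero`). In the language of forms: `∧_i (dz_i ∧ ∂̄ f_i)` is exact.
[folklore] -/
theorem integral_det_dbarAlong_eq_zero {f : Fin n → (Fin n → ℂ) → ℂ}
    (hf : ∀ i, ContDiff ℝ 2 (f i)) {k₀ : Fin n} (hk₀ : HasCompactSupport (f k₀)) :
    ∫ w, (Matrix.of fun i l ↦ dbarAlong (Pi.single l 1) (f i) w).det = 0 := by
  -- the cofactors `G k`
  set G : Fin n → (Fin n → ℂ) → ℂ := fun k w ↦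
    ((Matrix.of fun i l ↦ dbarAlong (Pi.single l 1) (f i) w).updateRow k₀ (Pi.single k 1)).det
    with hG
  have hGdiff : ∀ k, ContDiff ℝ 1 (G k) := by
    intro k
    refine contDiff_matrix_det fun i l ↦ ?_
    by_cases hi : i = k₀
    · subst hi
      simp only [Matrix.updateRow_self]
      exact contDiff_const
    · simp only [Matrix.updateRow_ne hi, Matrix.of_apply]
      exact contDiff_dbarAlong (hf i) _
  have hf1 : ContDiff ℝ 1 (f k₀) := (hf k₀).of_le (by norm_num)
  -- expansion along the row `k₀`
  have hexp : ∀ w, (Matrix.of fun i l ↦ dbarAlong (Pi.single l 1) (f i) w).det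
      = ∑ k, dbarAlong (Pi.single k 1) (f k₀) w * G k w := by
    intro w
    rw [Matrix.det_eq_sum_mul_adjugate_row _ k₀]
    refine Finset.sum_congr rfl fun k _ ↦ ?_
    rw [Matrix.of_apply, Matrix.adjugate_apply]
  simp_rw [hexp]
  -- integrability of the terms
  have hdbar_cont : ∀ k, Continuous fun w ↦ dbarAlong (Pi.single k 1) (f k₀) w := fun k ↦
    (contDiff_dbarAlong (k := 1) (hf k₀) _).continuous
  have hdbar_supp : ∀ k, HasCompactSupport fun w ↦ dbarAlong (Pi.single k 1) (f k₀) w :=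
    fun k ↦ hasCompactSupport_dbarAlong hk₀ _
  have hint : ∀ k, Integrable fun w ↦ dbarAlong (Pi.single k 1) (f k₀) w * G k w := fun k ↦
    ((hdbar_cont k).mul (hGdiff k).continuous).integrable_of_hasCompactSupport
      (hdbar_supp k).mul_right
  rw [integral_finsetSum _ fun k _ ↦ hint k]
  simp_rw [fun k ↦ integral_dbarAlong_mul_eq_neg hf1 (hGdiff k) hk₀ (Pi.single k 1)]
  have hint2 : ∀ k, Integrable fun w ↦ f k₀ w * dbarAlong (Pi.single k 1) (G k) w := fun k ↦
    ((hf k₀).continuous.mul (contDiff_dbarAlong (k := 0) (hGdiff k) _).continuous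
      ).integrable_of_hasCompactSupport hk₀.mul_right
  rw [Finset.sum_neg_distrib, ← integral_finsetSum _ fun k _ ↦ hint2 k, neg_eq_zero]
  simp_rw [← Finset.mul_sum]
  have hzero : ∀ w, ∑ k, dbarAlong (Pi.single k 1) (G k) w = 0 := fun w ↦
    sum_dbarAlong_det_updateRow_eq_zero hf k₀ w
  simp [hzero]

end Integral

/-! ### The Levi matrix as a matrix of `∂̄`-gradients -/

section Bridge

open Literature.AlgebraicGeometry.HodgeTheory.BiextensionHeight (leviMatrix)

variable {n : ℕ}

/-- For real `u` differentiable at `y`: `conj (∂̄_v u)(y) = ½ Du(y)[v] - ½ i Du(y)[iv]`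
(`= ∂_v u`, the holomorphic Wirtinger derivative). [folklore] -/
theorem conj_dbarAlong_ofReal {u : (Fin n → ℂ) → ℝ} {y : Fin n → ℂ} (hu : DifferentiableAt ℝ u y)
    (v : Fin n → ℂ) :
    conj (dbarAlong v (fun y ↦ (u y : ℂ)) y)
      = 2⁻¹ * ((fderiv ℝ u y v : ℝ) : ℂ) - 2⁻¹ * I * ((fderiv ℝ u y (I • v) : ℝ) : ℂ) := by
  have hD : fderiv ℝ (fun y ↦ (u y : ℂ)) y = Complex.ofRealCLM.comp (fderiv ℝ u y) :=
    (Complex.ofRealCLM.hasFDerivAt.comp y hu.hasFDerivAt).fderiv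
  rw [dbarAlong_eq, hD]
  simp only [ContinuousLinearMap.coe_comp, Function.comp_apply, Complex.ofRealCLM_apply]
  rw [map_div₀, map_add, map_mul, Complex.conj_I, Complex.conj_ofReal, Complex.conj_ofReal,
    map_ofNat]
  ring

/-- **The Levi matrix is a matrix of `∂̄`-gradients**: for `u` real of class `C²` at `w`,
`(leviMatrix u w)_{il} = ∂̄_{e_l} F_i (w)` with `F_i = conj ∘ ∂̄_{e_i} u = ∂u/∂w_i`, i.e.
`∂²u/∂w_i∂w̄_l` in Wirtinger notation. [folklore] -/
theorem leviMatrix_eq_dbarAlong {u : (Fin n → ℂ) → ℝ} {w : Fin n → ℂ} (hu : ContDiffAt ℝ 2 u w)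
    (i l : Fin n) :
    leviMatrix u w i l = dbarAlong (Pi.single l 1)
      (fun y ↦ conj (dbarAlong (Pi.single i 1) (fun y ↦ (u y : ℂ)) y)) w := by
  set A := fderiv ℝ (fderiv ℝ u) w with hA
  have hsymm : ∀ a b, A a b = A b a := fun a b ↦ (hu.isSymmSndFDerivAt (by simp)) a b
  -- the function near `w`
  set G : (Fin n → ℂ) → ℂ := fun y ↦ 2⁻¹ * ((fderiv ℝ u y (Pi.single i 1) : ℝ) : ℂ)
    - 2⁻¹ * I * ((fderiv ℝ u y (I • Pi.single i 1) : ℝ) : ℂ) with hG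
  have hev : (fun y ↦ conj (dbarAlong (Pi.single i 1) (fun y ↦ (u y : ℂ)) y)) =ᶠ[𝓝 w] G := by
    filter_upwards [hu.eventually (by simp)] with y hy
    exact conj_dbarAlong_ofReal (hy.differentiableAt (by simp)) _
  -- its derivative at `w`
  have h2 : HasFDerivAt (fderiv ℝ u) A w :=
    ((hu.fderiv_right (m := 1) le_rfl).differentiableAt one_ne_zero).hasFDerivAt
  have hT : ∀ v : Fin n → ℂ, HasFDerivAt (fun y ↦ ((fderiv ℝ u y v : ℝ) : ℂ))
      (Complex.ofRealCLM.comp ((ContinuousLinearMap.apply ℝ ℝ v).comp A)) w := fun v ↦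
    Complex.ofRealCLM.hasFDerivAt.comp w ((ContinuousLinearMap.apply ℝ ℝ v).hasFDerivAt.comp w h2)
  have hG' : HasFDerivAt G
      ((2⁻¹ : ℂ) • Complex.ofRealCLM.comp ((ContinuousLinearMap.apply ℝ ℝ (Pi.single i 1)).comp A)
        - (2⁻¹ * I : ℂ) • Complex.ofRealCLM.comp
          ((ContinuousLinearMap.apply ℝ ℝ (I • Pi.single i 1)).comp A)) w :=
    ((hT _).const_mul (2⁻¹ : ℂ)).sub ((hT _).const_mul (2⁻¹ * I : ℂ))
  rw [dbarAlong_apply, hev.fderiv_eq, hG'.fderiv, leviMatrix_apply]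
  simp only [_root_.sub_apply, _root_.smul_apply, ContinuousLinearMap.coe_comp,
    Function.comp_apply, ContinuousLinearMap.apply_apply, Complex.ofRealCLM_apply, smul_eq_mul,
    ← hA, hsymm (Pi.single l 1) (Pi.single i 1), hsymm (I • Pi.single l 1) (I • Pi.single i 1),
    hsymm (I • Pi.single l 1) (Pi.single i 1), hsymm (Pi.single l 1) (I • Pi.single i 1)]
  apply Complex.ext
  · simp [Complex.div_ofNat_re]
    ring
  · simp [Complex.div_ofNat_im]
    ring

/-- The Levi matrix is additive in the function (at `C²` points). [folklore] -/
theorem leviMatrix_add {u v : (Fin n → ℂ) → ℝ} {w : Fin n → ℂ} (hu : ContDiffAt ℝ 2 u w)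
    (hv : ContDiffAt ℝ 2 v w) : leviMatrix (u + v) w = leviMatrix u w + leviMatrix v w := by
  ext p q
  simp only [leviMatrix, iteratedFDeriv_add_apply hu hv, Matrix.add_apply, _root_.add_apply]
  push_cast
  ring

end Bridge

/-! ### Total Monge–Ampère mass of compactly supported perturbations -/

section TotalMass

open Literature.AlgebraicGeometry.HodgeTheory.BiextensionHeight (leviMatrix heightDensity)

variable {N : ℕ}

/-- **Telescoping expansion of `det(A + B) - det A`** by multilinearity in the rows: the `j`-th
term has rows `i < j` from `A + B`, row `j` from `B` and rows `i > j` from `A`. [folklore] -/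
theorem det_add_sub_det_eq_sum (A B : Matrix (Fin N) (Fin N) ℂ) :
    (A + B).det - A.det = ∑ j : Fin N, (Matrix.of fun i l ↦
      if i < j then (A + B) i l else if i = j then B i l else A i l).det := by
  set C : ℕ → Matrix (Fin N) (Fin N) ℂ := fun m ↦
    Matrix.of fun i l ↦ if i.val < m then (A + B) i l else A i l with hC
  have hC0 : C 0 = A := by
    ext i l; simp [hC]
  have hCN : C N = A + B := by
    ext i l; simp [hC, i.isLt]
  have hstep : ∀ j : Fin N, (C (j.val + 1)).det - (C j.val).det = (Matrix.of fun i l ↦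
      if i < j then (A + B) i l else if i = j then B i l else A i l).det := by
    intro j
    have h1 : C (j.val + 1) = (C j.val).updateRow j (A j + B j) := by
      ext i l
      by_cases hij : i = j
      · subst hij
        simp [hC]
      · have hne : i.val ≠ j.val := Fin.val_ne_of_ne hij
        simp only [hC, Matrix.of_apply, Matrix.updateRow_ne hij]
        split_ifs <;> first | rfl | omega
    have h2 : (C j.val).updateRow j (A j) = C j.val := by
      ext i l
      by_cases hij : i = j
      · subst hij
        simp [hC]
      · simp only [Matrix.updateRow_ne hij]
    have h3 : (C j.val).updateRow j (B j) = (Matrix.of fun i l ↦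
        if i < j then (A + B) i l else if i = j then B i l else A i l) := by
      ext i l
      by_cases hij : i = j
      · subst hij
        simp [hC]
      · simp only [hC, Matrix.of_apply, Matrix.updateRow_ne hij, hij, if_false, Fin.lt_def]
    rw [h1, Matrix.det_updateRow_add, h2, h3]
    ring
  have htel : ∑ j : Fin N, ((C (j.val + 1)).det - (C j.val).det) = (C N).det - (C 0).det := by
    rw [Fin.sum_univ_eq_sum_range (fun m ↦ (C (m + 1)).det - (C m).det) N]
    exact Finset.sum_range_sub (fun m ↦ (C m).det) N
  rw [hCN, hC0] at htel
  rw [← htel]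
  exact Finset.sum_congr rfl fun j _ ↦ hstep j

/-- Entries of the Levi matrix of a `C²` function are continuous. [folklore] -/
theorem continuous_leviMatrix_apply_of_contDiff_two {u : (Fin N → ℂ) → ℝ} (hu : ContDiff ℝ 2 u) (i l : Fin N) :
    Continuous fun w ↦ leviMatrix u w i l := by
  have hc : ∀ m : Fin 2 → (Fin N → ℂ), Continuous fun w ↦ iteratedFDeriv ℝ 2 u w m := fun m ↦
    (ContinuousMultilinearMap.apply ℝ (fun _ : Fin 2 ↦ Fin N → ℂ) ℝ m).continuous.comp
      (hu.continuous_iteratedFDeriv le_rfl)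
  unfold leviMatrix
  fun_prop

/-- The Monge–Ampère density of a `C²` function is continuous. [folklore] -/
theorem continuous_heightDensity_self {u : (Fin N → ℂ) → ℝ} (hu : ContDiff ℝ 2 u) :
    Continuous fun w ↦ heightDensity N u w := by
  have hdet : Continuous fun w ↦ (leviMatrix u w).det :=
    (continuous_matrix fun i l ↦ continuous_leviMatrix_apply_of_contDiff_two hu i l).matrix_det
  simp_rw [heightDensity_self_eq]
  exact continuous_const.mul (Complex.continuous_re.comp hdet)

/-- The Levi matrix only depends on the germ of the function. [folklore] -/
theorem leviMatrix_congr_of_eventuallyEq {u v : (Fin N → ℂ) → ℝ} {w : Fin N → ℂ}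
    (h : u =ᶠ[𝓝 w] v) : leviMatrix u w = leviMatrix v w := by
  ext i l
  simp only [leviMatrix, (h.iteratedFDeriv ℝ 2).self_of_nhds]

/-- **`∫ (det L(q + φ) - det L(q)) dλ = 0`** for `q, φ` of class `C³` with `φ` compactly supported
(`L = leviMatrix`, the complex Hessian): each term of the telescoping expansion is the determinant
of a matrix of `∂̄`-gradients with a compactly supported row. [folklore] -/
theorem integral_det_leviMatrix_add_sub_eq_zero {q φ : (Fin N → ℂ) → ℝ} (hq : ContDiff ℝ 3 q)
    (hφ : ContDiff ℝ 3 φ) (hφc : HasCompactSupport φ) :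
    (∫ w, ((leviMatrix (q + φ) w).det - (leviMatrix q w).det)) = 0 ∧
      Integrable fun w ↦ (leviMatrix (q + φ) w).det - (leviMatrix q w).det := by
  have hq2 : ContDiff ℝ 2 q := hq.of_le (by norm_num)
  have hφ2 : ContDiff ℝ 2 φ := hφ.of_le (by norm_num)
  -- the `j`-th term
  have key : ∀ j : Fin N,
      (∫ w, (Matrix.of fun i l ↦ if i < j then (leviMatrix q w + leviMatrix φ w) i l
        else if i = j then leviMatrix φ w i l else leviMatrix q w i l).det) = 0 ∧
      Integrable fun w ↦ (Matrix.of fun i l ↦ if i < j then (leviMatrix q w + leviMatrix φ w) i l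
        else if i = j then leviMatrix φ w i l else leviMatrix q w i l).det := by
    intro j
    set uu : Fin N → (Fin N → ℂ) → ℝ := fun i ↦ if i < j then q + φ else if i = j then φ else q
      with huu
    set f : Fin N → (Fin N → ℂ) → ℂ := fun i y ↦
      conj (dbarAlong (Pi.single i 1) (fun y ↦ (uu i y : ℂ)) y) with hfdef
    have huu3 : ∀ i, ContDiff ℝ 3 (uu i) := by
      intro i; simp only [huu]; split_ifs; exacts [hq.add hφ, hφ, hq]
    have huuC : ∀ i, ContDiff ℝ 3 fun y ↦ (uu i y : ℂ) := fun i ↦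
      Complex.ofRealCLM.contDiff.comp (huu3 i)
    have hf2 : ∀ i, ContDiff ℝ 2 (f i) := fun i ↦
      Complex.conjCLE.contDiff.comp (contDiff_dbarAlong (k := 2) (huuC i) _)
    have hfc : HasCompactSupport (f j) := by
      have hφC : HasCompactSupport fun y ↦ (uu j y : ℂ) := by
        have : uu j = φ := by simp [huu]
        rw [this]
        exact hφc.comp_left Complex.ofReal_zero
      exact (hasCompactSupport_dbarAlong hφC _).comp_left (map_zero conj)
    have hmat : ∀ w, (Matrix.of fun i l ↦ if i < j then (leviMatrix q w + leviMatrix φ w) i l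
        else if i = j then leviMatrix φ w i l else leviMatrix q w i l)
          = Matrix.of fun i l ↦ dbarAlong (Pi.single l 1) (f i) w := by
      intro w
      ext i l
      simp only [Matrix.of_apply, hfdef, huu]
      split_ifs with h1 h2
      · rw [← leviMatrix_add hq2.contDiffAt hφ2.contDiffAt]
        exact leviMatrix_eq_dbarAlong (hq2.add hφ2).contDiffAt i l
      · exact leviMatrix_eq_dbarAlong hφ2.contDiffAt i l
      · exact leviMatrix_eq_dbarAlong hq2.contDiffAt i l
    simp_rw [hmat]
    refine ⟨integral_det_dbarAlong_eq_zero hf2 hfc, ?_⟩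
    -- integrability: continuous with compact support (row `j` is compactly supported)
    have hcont : Continuous fun w ↦ (Matrix.of fun i l ↦ dbarAlong (Pi.single l 1) (f i) w).det :=
      (contDiff_matrix_det (k := 1) fun i l ↦ contDiff_dbarAlong (hf2 i) _).continuous
    have hsupp : HasCompactSupport fun w ↦
        (Matrix.of fun i l ↦ dbarAlong (Pi.single l 1) (f i) w).det := by
      refine HasCompactSupport.intro (isCompact_iUnion fun l : Fin N ↦
        (hasCompactSupport_dbarAlong hfc (Pi.single l 1)).isCompact) fun w hw ↦ ?_
      refine Matrix.det_eq_zero_of_row_eq_zero j fun l ↦ ?_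
      simp only [Matrix.of_apply]
      simp only [Set.mem_iUnion, not_exists] at hw
      exact image_eq_zero_of_notMem_tsupport (hw l)
    exact hcont.integrable_of_hasCompactSupport hsupp
  -- assemble
  have hsum : ∀ w, (leviMatrix (q + φ) w).det - (leviMatrix q w).det
      = ∑ j : Fin N, (Matrix.of fun i l ↦ if i < j then (leviMatrix q w + leviMatrix φ w) i l
        else if i = j then leviMatrix φ w i l else leviMatrix q w i l).det := by
    intro w
    rw [leviMatrix_add hq2.contDiffAt hφ2.contDiffAt]
    exact det_add_sub_det_eq_sum _ _
  simp_rw [hsum]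
  refine ⟨?_, integrable_finsetSum _ fun j _ ↦ (key j).2⟩
  rw [integral_finsetSum _ fun j _ ↦ (key j).2]
  exact Finset.sum_eq_zero fun j _ ↦ (key j).1

/-- **Compactly supported perturbations do not change the total Monge–Ampère mass** (smooth
case, signed form): `∫ (MA(q + φ) - MA(q)) dλ = 0` for `q, φ ∈ C³(ℂᴺ)`, `φ` compactly supported,
`MA = heightDensity N = N!(2/π)ᴺ Re det L`. [folklore] -/
theorem integral_heightDensity_add_sub_eq_zero {q φ : (Fin N → ℂ) → ℝ} (hq : ContDiff ℝ 3 q)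
    (hφ : ContDiff ℝ 3 φ) (hφc : HasCompactSupport φ) :
    (∫ w, (heightDensity N (q + φ) w - heightDensity N q w)) = 0 ∧
      Integrable fun w ↦ heightDensity N (q + φ) w - heightDensity N q w := by
  obtain ⟨hint0, hint⟩ := integral_det_leviMatrix_add_sub_eq_zero hq hφ hφc
  have h : ∀ w, heightDensity N (q + φ) w - heightDensity N q w
      = (N.factorial : ℝ) * (2 / Real.pi) ^ N
        * ((leviMatrix (q + φ) w).det - (leviMatrix q w).det).re := by
    intro w
    rw [heightDensity_self_eq, heightDensity_self_eq, Complex.sub_re]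
    ring
  simp_rw [h]
  refine ⟨?_, (hint.re.const_mul _)⟩
  have hre := integral_re hint
  simp only [RCLike.re_to_complex] at hre
  rw [integral_const_mul, hre, hint0, Complex.zero_re, mul_zero]

/-- **Compactly supported perturbations do not change the total Monge–Ampère mass** (`[0, ∞]`
form): if moreover `MA(q) ≥ 0` and `MA(q + φ) ≥ 0` pointwise then
`∫⁻ MA(q + φ) = ∫⁻ MA(q)`. [folklore] -/
theorem lintegral_heightDensity_add_eq {q φ : (Fin N → ℂ) → ℝ} (hq : ContDiff ℝ 3 q)
    (hφ : ContDiff ℝ 3 φ) (hφc : HasCompactSupport φ) (hq0 : ∀ w, 0 ≤ heightDensity N q w)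
    (hqφ0 : ∀ w, 0 ≤ heightDensity N (q + φ) w) :
    ∫⁻ w, ENNReal.ofReal (heightDensity N (q + φ) w) = ∫⁻ w, ENNReal.ofReal (heightDensity N q w) := by
  have hq2 : ContDiff ℝ 2 q := hq.of_le (by norm_num)
  have hφ2 : ContDiff ℝ 2 φ := hφ.of_le (by norm_num)
  obtain ⟨hD0, hDint⟩ := integral_heightDensity_add_sub_eq_zero hq hφ hφc
  have hcq : Continuous fun w ↦ heightDensity N q w := continuous_heightDensity_self hq2
  have hcqφ : Continuous fun w ↦ heightDensity N (q + φ) w := continuous_heightDensity_self (hq2.add hφ2)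
  -- the difference vanishes off the support of `φ`
  set K := tsupport φ with hK
  have hKc : IsCompact K := hφc
  have hoff : ∀ w, w ∉ K → heightDensity N (q + φ) w = heightDensity N q w := by
    intro w hw
    have hev : (q + φ) =ᶠ[𝓝 w] q := by
      have : φ =ᶠ[𝓝 w] 0 := by
        rw [hK, notMem_tsupport_iff_eventuallyEq] at hw
        exact hw
      filter_upwards [this] with y hy
      simp [hy]
    rw [heightDensity_self_eq, heightDensity_self_eq, leviMatrix_congr_of_eventuallyEq hev]
  -- split the integrals along `K` (all steps by explicit terms: unification must never compare
  -- `heightDensity N (q + φ)` with `heightDensity N q`, which is expensive)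
  have e1 := lintegral_add_compl (μ := volume)
    (fun w ↦ ENNReal.ofReal (heightDensity N (q + φ) w)) hKc.measurableSet
  have e2 := lintegral_add_compl (μ := volume)
    (fun w ↦ ENNReal.ofReal (heightDensity N q w)) hKc.measurableSet
  -- on `K`: both densities are integrable and the signed difference integrates to zero
  have hiq : IntegrableOn (fun w ↦ heightDensity N q w) K :=
    hcq.continuousOn.integrableOn_compact hKc
  have hiqφ : IntegrableOn (fun w ↦ heightDensity N (q + φ) w) K :=
    hcqφ.continuousOn.integrableOn_compact hKc
  have a1 := ofReal_integral_eq_lintegral_ofReal hiqφ (ae_of_all _ fun w ↦ hqφ0 w)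
  have a2 := ofReal_integral_eq_lintegral_ofReal hiq (ae_of_all _ fun w ↦ hq0 w)
  have a3 : ∫ w in K, heightDensity N (q + φ) w = ∫ w in K, heightDensity N q w := by
    have hsplit : (fun w ↦ heightDensity N (q + φ) w)
        = fun w ↦ heightDensity N q w + (heightDensity N (q + φ) w - heightDensity N q w) := by
      funext w; ring
    have hD : ∫ w in K, (heightDensity N (q + φ) w - heightDensity N q w) = 0 := by
      rw [setIntegral_eq_integral_of_forall_compl_eq_zero (fun w hw ↦ by rw [hoff w hw, sub_self])]
      exact hD0
    rw [hsplit, integral_add hiq hDint.integrableOn, hD, add_zero]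
  have hK1 : ∫⁻ w in K, ENNReal.ofReal (heightDensity N (q + φ) w)
      = ∫⁻ w in K, ENNReal.ofReal (heightDensity N q w) :=
    a1.symm.trans ((congrArg ENNReal.ofReal a3).trans a2)
  have hK2 : ∫⁻ w in Kᶜ, ENNReal.ofReal (heightDensity N (q + φ) w)
      = ∫⁻ w in Kᶜ, ENNReal.ofReal (heightDensity N q w) :=
    setLIntegral_congr_fun hKc.measurableSet.compl fun w hw ↦ by rw [hoff w hw]
  exact e1.symm.trans ((congrArg₂ (· + ·) hK1 hK2).trans e2)

end TotalMass

end Literature.Analysis.Pluripotential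

end
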